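import Literature.Barriers.FinalStateConjecture.NonSmoothNullInfinityLogBase
import HarnessLib

/-!
# Barrier catalogue `FinalStateConjecture`: the linear scattering problem on Schwarzschild —
# `u`-derivatives of the scattering field and the decay estimate (6.17) at order `n = 0` for all
# `∂ᵤ`-derivatives
(`Literature/Barriers/FinalStateConjecture/`, D-0021, D-0014; namespace
`Literature.Barriers.FinalStateConjecture`, sub-namespace `ScatDecay`)

Kehrberger proves the `|u|`-decay (6.17) of Thm. 6.2 (arXiv:2105.08079v3) by induction on the number
of vanishing moments, writing `rφ = ∂ᵤ(rφ^T) + ∂ᵥ(rφ^T)` with the time integral `rφ^T`; the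
induction hypothesis must therefore be carried "for all `u`-derivatives" ("(6.17) [...] commuted with
`∂ᵤ^m`", proof of Thm. 6.2). This file provides the base of that tower, i.e. Thm. 6.1/(6.17) at
`n = 0` for every `∂ᵤ^a` of the constructed field `χ` (data `H` smooth, supported in `(v₁, v₂)`), on
the early-time region `GoodRegion M r v₁ v₂ U₀ A`:

* `u`-derivatives of polynomials in `1/r`: `∂ᵤ^m P(ρ) = (−1)^m (δ^m P)(ρ)` (`∂ᵤ(1/r) = −∂ᵥ(1/r)`),
  so `|∂ᵤ^m V| ≤ K_m/r^{3+m}` and `∂ᵤ^m V = (−1)^m ρ^{3+m} S_m(ρ)` with `(−1)^m S_m(0) = (m+2)! M`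
  (`ScatDecay.iteratedDeriv_eval_invRadius_left`, `iteratedDeriv_potential_left_eq`);
* `∂ᵤ^m (V f) = V f_m` in the bootstrap family and **`∂ᵤ^{m+1} χ = −∫_{v₁}^{v} ∂ᵤ^m(Vχ) dv'`**
  (`ScatDecay.iteratedDeriv_succ_field_left`, differentiation under the `v`-integral);
* **the base tower** (`ScatDecay.uDeriv_base`): for every `a`,
  `|∂ᵤ^a (χ − H)(u, v)| ≤ C/|u|^{2+a}` for `v ≥ v₁` and
  `|∂ᵤ^a χ(u, v) + I₀[H] (a+1)!/|u|^{2+a}| ≤ C log|u|/|u|^{3+a}` for `v ≥ v₂` (`u ≤ U₀`),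
  by induction on `a` with the Leibniz rule, the strip comparison `|1/r^k − 1/|u|^k| ≤ C log|u|/|u|^{k+1}`
  and the outgoing rule — Kehrberger's (6.17) at `n = 0` with `∂ᵤ^a` commuted ("`∂ᵤ = −D∂_r` on
  functions of `r`": the leading term `−I₀(a+1)!/|u|^{2+a}` is `∂ᵤ^a` of `−I₀/u²`).

## References

* L. M. A. Kehrberger, *The case against smooth null infinity I*, Ann. Henri Poincaré 23 (2022)
  829–921 = arXiv:2105.08079 (v3, 2023), Thm. 6.1 eq. (6.3), proof of Thm. 6.2 (eq. (6.17) for all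
  `u`-derivatives), §6.2 footnote 55. Key `Kehrberger2022AHP`.
-/

noncomputable section

open Set Filter Topology MeasureTheory intervalIntegral Function Asymptotics Polynomial

namespace Literature.Barriers.FinalStateConjecture

namespace ScatDecay

/-! ### `u`-derivatives of polynomials in `1/r` -/

section UDerivPoly

variable {M : ℝ} {r : ℝ → ℝ → ℝ} (hr : IsEFAreaRadius M r) (hM : 0 < M)
include hr hM

/-- `∂ᵤ P(1/r) = −(δP)(1/r)` (`∂ᵤ(1/r) = −∂ᵥ(1/r)`). [folklore] -/
lemma hasDerivAt_eval_invRadius_left_vDerivPoly (P : ℝ[X]) (u v : ℝ) :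
    HasDerivAt (fun u' ↦ P.eval (r u' v)⁻¹) (-(vDerivPoly M P).eval (r u v)⁻¹) u := by
  have h := hasDerivAt_eval_invRadius_left hr hM P u v
  simpa [vDerivPoly] using h

/-- **`∂ᵤ^m P(1/r) = (−1)^m (δ^m P)(1/r)`.** [folklore] -/
theorem iteratedDeriv_eval_invRadius_left (P : ℝ[X]) (m : ℕ) (u v : ℝ) :
    iteratedDeriv m (fun u' ↦ P.eval (r u' v)⁻¹) u = (-1) ^ m * ((vDerivPoly M)^[m] P).eval (r u v)⁻¹ := by
  induction m generalizing P u with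
  | zero => simp
  | succ m ih =>
    rw [iteratedDeriv_succ', Function.iterate_succ_apply]
    have hd : deriv (fun u' ↦ P.eval (r u' v)⁻¹) = fun u' ↦ -(vDerivPoly M P).eval (r u' v)⁻¹ :=
      funext fun u' ↦ (hasDerivAt_eval_invRadius_left_vDerivPoly hr hM P u' v).deriv
    rw [hd, iteratedDeriv_fun_neg, ih]
    ring

/-- **`∂ᵤ^m V(r(·, v)) = (−1)^m ρ^{3+m} S_m(ρ)`** with the cofactors of `potentialPoly`. [folklore] -/
theorem iteratedDeriv_potential_left_eq (m : ℕ) (u v : ℝ) :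
    iteratedDeriv m (fun u' ↦ radialPotential M (r u' v)) u =
      (-1) ^ m * (((r u v)⁻¹) ^ (3 + m) * (vDerivCofactor M 3 (C (2 * M) - C (4 * M ^ 2) * X) m).eval (r u v)⁻¹) := by
  have heq : (fun u' ↦ radialPotential M (r u' v)) = fun u' ↦ (potentialPoly M).eval (r u' v)⁻¹ :=
    funext fun u' ↦ radialPotential_eq_eval hr hM u' v
  rw [heq, iteratedDeriv_eval_invRadius_left hr hM, potentialPoly_eq_X_pow_mul,
    iterate_vDerivPoly_X_pow_mul (by norm_num)]
  simp [eval_mul, eval_pow]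

/-- **`|∂ᵤ^m V(r(·, v))| ≤ K_m / r^{3+m}`.** [folklore] -/
theorem abs_iteratedDeriv_potential_left_le (m : ℕ) :
    ∃ K : ℝ, 0 ≤ K ∧ ∀ u v, |iteratedDeriv m (fun u' ↦ radialPotential M (r u' v)) u| ≤ K * (r u v ^ (3 + m))⁻¹ := by
  obtain ⟨K, hK⟩ := exists_bound_eval_invRadius hr hM (vDerivCofactor M 3 (C (2 * M) - C (4 * M ^ 2) * X) m)
  refine ⟨K, (abs_nonneg _).trans (hK 0 0), fun u v ↦ ?_⟩
  have h0 : 0 < r u v := hr.pos hM.le u v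
  rw [iteratedDeriv_potential_left_eq hr hM, abs_mul, abs_pow, abs_neg, abs_one, one_pow, one_mul,
    abs_mul, ← inv_pow, abs_of_nonneg (by positivity), mul_comm]
  exact mul_le_mul_of_nonneg_right (hK u v) (by positivity)

omit hr hM in
/-- `3·4⋯(m+2) · 2 = (m+2)!`. [folklore] -/
lemma prod_range_three_mul_two : ∀ m : ℕ, (∏ i ∈ Finset.range m, ((3 : ℝ) + i)) * 2 = ((m + 2).factorial : ℝ)
  | 0 => by simp
  | k + 1 => by
    rw [Finset.prod_range_succ, show k + 1 + 2 = (k + 2) + 1 by ring, Nat.factorial_succ (k + 2)]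
    have ih := prod_range_three_mul_two k
    push_cast
    linear_combination ((3 : ℝ) + k) * ih

/-- The same bound with the lowest coefficient split off:
`∂ᵤ^m V = (m+2)! M ρ^{3+m} + (−1)^m ρ^{3+m} (S_m(ρ) − S_m(0))`, where `(−1)^m S_m(0) = (m+2)! M`.
[folklore] -/
theorem iteratedDeriv_potential_left_eq_leading (m : ℕ) (u v : ℝ) :
    iteratedDeriv m (fun u' ↦ radialPotential M (r u' v)) u =
      ((m + 2).factorial : ℝ) * M * (r u v ^ (3 + m))⁻¹ +
      (-1) ^ m * (r u v ^ (3 + m))⁻¹ * ((vDerivCofactor M 3 (C (2 * M) - C (4 * M ^ 2) * X) m).eval (r u v)⁻¹ -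
        (vDerivCofactor M 3 (C (2 * M) - C (4 * M ^ 2) * X) m).eval 0) := by
  rw [iteratedDeriv_potential_left_eq hr hM, inv_pow]
  have h0 : (vDerivCofactor M 3 (C (2 * M) - C (4 * M ^ 2) * X) m).eval 0 =
      (-1) ^ m * (∏ i ∈ Finset.range m, ((3 : ℝ) + i)) * (2 * M) := by
    rw [VExp.vDerivCofactor_eval_zero]
    simp [eval_sub, eval_mul, eval_C, eval_X]
  have hfac := prod_range_three_mul_two m
  have hsq : ((-1 : ℝ) ^ m) * (-1) ^ m = 1 := by rw [← mul_pow]; simp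
  rw [h0]
  linear_combination (M * (r u v ^ (3 + m))⁻¹ * ((∏ i ∈ Finset.range m, ((3 : ℝ) + i)) * 2)) * hsq +
    (M * (r u v ^ (3 + m))⁻¹) * hfac

/-- `u ↦ P(1/r(u, v))` is smooth. [folklore] -/
theorem contDiff_eval_invRadius_left (P : ℝ[X]) (v : ℝ) :
    ContDiff ℝ ((⊤ : ℕ∞) : WithTop ℕ∞) (fun u ↦ P.eval (r u v)⁻¹) := by
  have hρ : ContDiff ℝ ((⊤ : ℕ∞) : WithTop ℕ∞) (fun u ↦ (r u v)⁻¹) :=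
    ((hr.contDiff_uncurry hM).comp (contDiff_prodMk_left v)).inv fun u ↦ (hr.pos hM.le u v).ne'
  have h := (Polynomial.contDiff_aeval (𝕜 := ℝ) P ((⊤ : ℕ∞) : WithTop ℕ∞)).comp hρ
  simpa [Function.comp_def] using h

/-- `u ↦ V(r(u, v))` is smooth. [folklore] -/
theorem contDiff_potential_left (v : ℝ) :
    ContDiff ℝ ((⊤ : ℕ∞) : WithTop ℕ∞) (fun u ↦ radialPotential M (r u v)) := by
  have heq : (fun u' ↦ radialPotential M (r u' v)) = fun u' ↦ (potentialPoly M).eval (r u' v)⁻¹ :=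
    funext fun u' ↦ radialPotential_eq_eval hr hM u' v
  rw [heq]; exact contDiff_eval_invRadius_left hr hM _ v

end UDerivPoly

/-! ### `u`-derivatives in the bootstrap family -/

section UFamilyDeriv

variable {M : ℝ} {r : ℝ → ℝ → ℝ} {v₁ : ℝ} {H : ℝ → ℝ} {ψ f : ℝ → ℝ → ℝ}
variable (hr : IsEFAreaRadius M r) (hM : 0 < M) (hb : ScatBootstrap M r v₁ H ψ)
include hr hM hb

/-- Slices `u ↦ f(u, v)` of members are smooth. [folklore] -/
theorem contDiff_left (hf : ScatFam M r v₁ H ψ f) (v : ℝ) :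
    ContDiff ℝ ((⊤ : ℕ∞) : WithTop ℕ∞) (fun u ↦ f u v) :=
  (ScatFam.contDiff hr hM hb hf).comp (contDiff_prodMk_left v)

/-- Slices `u ↦ V(u,v) f(u, v)` are smooth. [folklore] -/
theorem contDiff_potential_mul_left (hf : ScatFam M r v₁ H ψ f) (v : ℝ) :
    ContDiff ℝ ((⊤ : ℕ∞) : WithTop ℕ∞) (fun u ↦ radialPotential M (r u v) * f u v) :=
  (contDiff_potential_left hr hM v).mul (contDiff_left hr hM hb hf v)

omit hr hM hb in
/-- Congruence for the family (equal functions). [folklore] -/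
lemma _root_.Literature.Barriers.FinalStateConjecture.ScatFam.congr {g : ℝ → ℝ → ℝ}
    (hf : ScatFam M r v₁ H ψ f) (hfg : f = g) : ScatFam M r v₁ H ψ g := hfg ▸ hf

/-- **`∂ᵤ^m (V f) = V · f_m` with `f_m` in the bootstrap family** (`f_{m+1} = −εᵥ(1)(ρ) f_m + ∂ᵤ f_m`).
[folklore] -/
theorem exists_iteratedDeriv_potential_mul_left (hf : ScatFam M r v₁ H ψ f) (m : ℕ) :
    ∃ fm : ℝ → ℝ → ℝ, ScatFam M r v₁ H ψ fm ∧ ∀ u v,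
      iteratedDeriv m (fun u' ↦ radialPotential M (r u' v) * f u' v) u = radialPotential M (r u v) * fm u v := by
  induction m with
  | zero => exact ⟨f, hf, fun u v ↦ by simp⟩
  | succ m ih =>
    obtain ⟨fm, hfm, heq⟩ := ih
    obtain ⟨f₁, _, hf₁, -, hd₁, -⟩ := ScatFam.exists_hasDerivAt hr hM hb hfm
    refine ⟨fun u v ↦ -(potentialDerivPoly M 1).eval (r u v)⁻¹ * fm u v + f₁ u v,
      ScatFam.add (ScatFam.smul (-potentialDerivPoly M 1) hfm |>.congr ?_) hf₁, fun u v ↦ ?_⟩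
    · funext u v; simp [eval_neg]
    have hfun : iteratedDeriv m (fun u' ↦ radialPotential M (r u' v) * f u' v) =
        fun u' ↦ radialPotential M (r u' v) * fm u' v := funext fun u' ↦ heq u' v
    rw [iteratedDeriv_succ, hfun]
    have h1 : HasDerivAt (fun u' ↦ (potentialPoly M).eval (r u' v)⁻¹ * fm u' v)
        ((derivative (potentialPoly M) * invRadiusDerivPoly M).eval (r u v)⁻¹ * fm u v +
          (potentialPoly M).eval (r u v)⁻¹ * f₁ u v) u :=
      (hasDerivAt_eval_invRadius_left hr hM _ u v).mul (hd₁ u v)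
    have heq' : (fun u' ↦ radialPotential M (r u' v) * fm u' v) =
        fun u' ↦ (potentialPoly M).eval (r u' v)⁻¹ * fm u' v :=
      funext fun u' ↦ by rw [radialPotential_eq_eval hr hM]
    rw [heq']
    refine (h1.congr_deriv ?_).deriv
    have hid := congrArg (fun Q : ℝ[X] ↦ Q.eval (r u v)⁻¹) (potentialPoly_identity M 1)
    simp only [mul_one, eval_mul, eval_neg] at hid
    rw [radialPotential_eq_eval hr hM]
    simp only [eval_mul, neg_mul] at hid ⊢
    linear_combination (-(fm u v)) * hid

/-- Joint continuity of `∂ᵤ^m (V f)`, from the representation `V · f_m`. [folklore] -/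
theorem continuous_iteratedDeriv_potential_mul_left (hf : ScatFam M r v₁ H ψ f) (m : ℕ) :
    Continuous (uncurry fun u v ↦ iteratedDeriv m (fun u' ↦ radialPotential M (r u' v) * f u' v) u) := by
  obtain ⟨fm, hfm, heq⟩ := exists_iteratedDeriv_potential_mul_left hr hM hb hf m
  have hfun : (uncurry fun u v ↦ iteratedDeriv m (fun u' ↦ radialPotential M (r u' v) * f u' v) u) =
      uncurry fun u v ↦ radialPotential M (r u v) * ((C (1 : ℝ)).eval (r u v)⁻¹ * fm u v) := by
    funext p; simp only [uncurry, heq p.1 p.2, eval_C, one_mul]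
  rw [hfun]
  exact ScatFam.continuous_uprimIntegrand hr hM hb (C 1) hfm

/-- **`∂ᵤ^m ∫_{v₁}^{v} V f = ∫_{v₁}^{v} ∂ᵤ^m (V f)`** for members `f` (differentiation under the
`v`-integral, iterated). [folklore] -/
theorem iteratedDeriv_vPrimitive (hf : ScatFam M r v₁ H ψ f) (m : ℕ) (u v : ℝ) :
    iteratedDeriv m (fun u' ↦ vPrimitive v₁ (fun u v ↦ radialPotential M (r u v) * f u v) u' v) u =
      vPrimitive v₁ (fun u v ↦ iteratedDeriv m (fun u' ↦ radialPotential M (r u' v) * f u' v) u) u v := by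
  induction m generalizing u with
  | zero => simp
  | succ m ih =>
    set F : ℕ → ℝ → ℝ → ℝ := fun m u v ↦ iteratedDeriv m (fun u' ↦ radialPotential M (r u' v) * f u' v) u
      with hF
    have hcm := continuous_iteratedDeriv_potential_mul_left hr hM hb hf m
    have hcm1 := continuous_iteratedDeriv_potential_mul_left hr hM hb hf (m + 1)
    have hd : ∀ u v, HasDerivAt (fun u' ↦ F m u' v) (F (m + 1) u v) u := by
      intro u v
      have hdiff := (contDiff_potential_mul_left hr hM hb hf v).differentiable_iteratedDeriv m
        (by exact_mod_cast ENat.coe_lt_top m)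
      simp only [hF, iteratedDeriv_succ]
      exact hdiff.differentiableAt.hasDerivAt
    have key := hasDerivAt_vPrimitive_left (v₁ := v₁) hcm hcm1 hd u v
    have hfun : iteratedDeriv m (fun u' ↦ vPrimitive v₁ (fun u v ↦ radialPotential M (r u v) * f u v) u' v) =
        fun u' ↦ vPrimitive v₁ (F m) u' v := funext fun u' ↦ ih u'
    rw [iteratedDeriv_succ, hfun]
    exact key.deriv

/-- **`∂ᵤ^{m+1} ψ = −∫_{v₁}^{v} ∂ᵤ^m (Vψ) dv'`** for the bootstrap field. [folklore] -/
theorem iteratedDeriv_succ_field_left (m : ℕ) (u v : ℝ) :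
    iteratedDeriv (m + 1) (fun u' ↦ ψ u' v) u =
      -vPrimitive v₁ (fun u v ↦ iteratedDeriv m (fun u' ↦ radialPotential M (r u' v) * ψ u' v) u) u v := by
  have hderiv : deriv (fun u' ↦ ψ u' v) =
      fun u' ↦ -vPrimitive v₁ (fun u v ↦ radialPotential M (r u v) * ψ u v) u' v :=
    funext fun u' ↦ (hb.deriv_left u' v).deriv
  rw [iteratedDeriv_succ', hderiv, iteratedDeriv_fun_neg, iteratedDeriv_vPrimitive hr hM hb ScatFam.sol m u v]

/-- All `u`-slices of the bootstrap field are smooth; `∂ᵤ^a ψ(·, v)` is differentiable.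
[folklore] -/
lemma contDiff_field_left (v : ℝ) : ContDiff ℝ ((⊤ : ℕ∞) : WithTop ℕ∞) (fun u ↦ ψ u v) :=
  contDiff_left hr hM hb ScatFam.sol v

end UFamilyDeriv

/-! ### The base tower: (6.17) at `n = 0` for all `u`-derivatives -/

section UDecayBase

variable {M : ℝ} {r : ℝ → ℝ → ℝ} {v₁ v₂ U₀ A : ℝ} {H : ℝ → ℝ} {CH : ℝ}
variable (hr : IsEFAreaRadius M r) (hM : 0 < M)
  (hHd : ContDiff ℝ ((⊤ : ℕ∞) : WithTop ℕ∞) H) (hsupp : tsupport H ⊆ Ioo v₁ v₂)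
  (hHb : ∀ v, |H v| ≤ CH) (hR : GoodRegion M r v₁ v₂ U₀ A) (h12 : v₁ ≤ v₂)
include hr hM hR h12

omit hr hM hR h12 in
/-- Shifting by the (in `u` constant) data does not change `u`-derivatives of positive order.
[folklore] -/
lemma iteratedDeriv_sub_data {χ : ℝ → ℝ → ℝ} {j : ℕ} (hj : 0 < j) (u v : ℝ) :
    iteratedDeriv j (fun u' ↦ χ u' v - H v) u = iteratedDeriv j (fun u' ↦ χ u' v) u := by
  rw [show (fun u' ↦ χ u' v - H v) = fun u' ↦ -H v + χ u' v from funext fun u' ↦ by ring]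
  exact iteratedDeriv_const_add hj _

omit hr hM hR h12 in
/-- **The data integral on the strip**: if `|φ| ≤ B` on `[v₁, v₂]` (`B ≥ 0`, `φ` continuous) then
`|∫_{v₁}^{v} H φ dv'| ≤ (v₂ − v₁) C_H B` for `v ≥ v₁` (the integrand lives on the strip). [folklore] -/
theorem abs_integral_data_mul_le' (hHc : Continuous H) (hsupp : tsupport H ⊆ Ioo v₁ v₂)
    (hHb : ∀ v, |H v| ≤ CH) (h12 : v₁ ≤ v₂) {φ : ℝ → ℝ} (hφ : Continuous φ) {B : ℝ} (hB0 : 0 ≤ B)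
    (hB : ∀ v' ∈ Icc v₁ v₂, |φ v'| ≤ B) {v : ℝ} (hv : v₁ ≤ v) :
    |∫ v' in v₁..v, H v' * φ v'| ≤ (v₂ - v₁) * CH * B := by
  have hCH := data_bound_nonneg hHb
  have hc : Continuous fun v' ↦ H v' * φ v' := hHc.mul hφ
  have hred : ∫ v' in v₁..v, H v' * φ v' = ∫ v' in v₁..min v v₂, H v' * φ v' := by
    rcases le_or_gt v v₂ with hv2 | hv2
    · rw [min_eq_left hv2]
    · rw [min_eq_right hv2.le, ← intervalIntegral.integral_add_adjacent_intervals (b := v₂)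
        (hc.intervalIntegrable _ _) (hc.intervalIntegrable _ _)]
      have hz : ∫ v' in v₂..v, H v' * φ v' = 0 := by
        rw [intervalIntegral.integral_congr (g := fun _ ↦ (0 : ℝ)) (fun v' hv' ↦ ?_)]
        · simp
        · rw [uIcc_of_le hv2.le] at hv'
          simp [data_eq_zero_of_ge hsupp hv'.1]
      rw [hz, add_zero]
  rw [hred]
  have hle : v₁ ≤ min v v₂ := le_min hv h12
  have h := intervalIntegral.norm_integral_le_of_norm_le_const (a := v₁) (b := min v v₂)
    (C := CH * B) (f := fun v' ↦ H v' * φ v') (fun v' hv' ↦ by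
      rw [uIoc_of_le hle] at hv'
      rw [Real.norm_eq_abs, abs_mul]
      exact mul_le_mul (hHb v') (hB v' ⟨hv'.1.le, hv'.2.trans (min_le_right _ _)⟩) (abs_nonneg _) hCH)
  rw [Real.norm_eq_abs] at h
  refine h.trans ?_
  rw [abs_of_nonneg (by linarith)]
  have hlen : min v v₂ - v₁ ≤ v₂ - v₁ := by linarith [min_le_right v v₂]
  nlinarith [mul_nonneg hCH hB0]

/-- **The induction step of the base tower.** Given `|∂ᵤ^j(χ − H)| ≤ C_p/|u|^{2+j}` on
`{u ≤ U₀, v ≥ v₁}` for `j ≤ a`: the bound `|∂ᵤ^{a+1}χ| ≤ C/|u|^{3+a}` there, and for `v ≥ v₂` the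
leading term `|∂ᵤ^{a+1}χ + I₀ (a+2)!/|u|^{3+a}| ≤ C log|u|/|u|^{4+a}`, via
`∂ᵤ^{a+1}χ = −∫_{v₁}^{v} ∂ᵤ^a(Vχ) dv'`, the Leibniz rule and `∂ᵤ^a V = (a+2)! M ρ^{3+a} + O(ρ^{4+a})`.
[cite: Kehrberger2022AHP, Thm. 6.1 eq. (6.3) and proof of Thm. 6.2] -/
theorem uDeriv_succ_of_lower (a : ℕ) {Cp : ℝ} (hCp : 0 ≤ Cp)
    (hprev : ∀ j, j ≤ a → ∀ u, u ≤ U₀ → ∀ v, v₁ ≤ v →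
      |iteratedDeriv j (fun u' ↦ scatteringField hr hM hHd.continuous hHb (data_eq_zero hsupp) u' v - H v) u| ≤
        Cp * ((-u) ^ (2 + j))⁻¹) :
    ∃ C : ℝ, 0 ≤ C ∧
      (∀ u, u ≤ U₀ → ∀ v, v₁ ≤ v →
        |iteratedDeriv (a + 1) (fun u' ↦ scatteringField hr hM hHd.continuous hHb (data_eq_zero hsupp) u' v) u| ≤
          C * ((-u) ^ (3 + a))⁻¹) ∧
      (∀ u, u ≤ U₀ → ∀ v, v₂ ≤ v →
        |iteratedDeriv (a + 1) (fun u' ↦ scatteringField hr hM hHd.continuous hHb (data_eq_zero hsupp) u' v) u +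
          (M * ∫ v' in v₁..v₂, H v') * ((a + 2).factorial : ℝ) * ((-u) ^ (3 + a))⁻¹| ≤
          C * Real.log (-u) * ((-u) ^ (4 + a))⁻¹) := by
  set χ := scatteringField hr hM hHd.continuous hHb (data_eq_zero hsupp) with hχ
  have hb : ScatBootstrap M r v₁ H χ := scatBootstrap_scatteringField hr hM hHd hsupp hHb
  have hCH := data_bound_nonneg hHb
  have hA := hR.A_nonneg
  choose K hK0 hK using fun i ↦ abs_iteratedDeriv_potential_left_le hr hM i
  set S : ℝ[X] := vDerivCofactor M 3 (C (2 * M) - C (4 * M ^ 2) * X) a with hS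
  obtain ⟨KS, hKS0, hKS⟩ := VExp.exists_abs_eval_sub_eval_zero_le hr hM S
  set T : ℝ := ∑ i ∈ Finset.range (a + 1), (a.choose i : ℝ) * K i * 2 ^ i * Cp with hT
  have hT0 : 0 ≤ T := Finset.sum_nonneg fun i _ ↦ by have := hK0 i; positivity
  set C₁ : ℝ := (v₂ - v₁) * CH * (K a * 2 ^ (3 + a)) + 4 * T with hC₁
  set C₂ : ℝ := ((a + 2).factorial : ℝ) * M * ((v₂ - v₁) * CH * (((3 + a : ℕ) : ℝ) * 4 ^ (3 + a) * A)) +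
    (v₂ - v₁) * CH * (KS * 2 ^ (4 + a)) + 4 * T with hC₂
  have h120 : 0 ≤ v₂ - v₁ := by linarith
  have hC₁0 : 0 ≤ C₁ := by have := hK0 a; positivity
  have hC₂0 : 0 ≤ C₂ := by positivity
  -- the two-variable objects
  set Fa : ℝ → ℝ → ℝ := fun u v ↦ iteratedDeriv a (fun u' ↦ radialPotential M (r u' v) * χ u' v) u with hFa
  set Va : ℝ → ℝ → ℝ := fun u v ↦ iteratedDeriv a (fun u' ↦ radialPotential M (r u' v)) u with hVa
  set G : ℝ → ℝ → ℝ := fun u v ↦ Fa u v - Va u v * H v with hG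
  have hle : ((a : ℕ) : WithTop ℕ∞) ≤ ((⊤ : ℕ∞) : WithTop ℕ∞) := by exact_mod_cast le_top
  have hVa_eq : ∀ u v, Va u v = (-1) ^ a * ((r u v ^ (3 + a))⁻¹ * S.eval (r u v)⁻¹) := by
    intro u v; simp only [hVa, hS]; rw [iteratedDeriv_potential_left_eq hr hM, inv_pow]
  -- continuity of the slices in `v`
  have hFac : ∀ u, Continuous fun v ↦ Fa u v := fun u ↦
    (continuous_iteratedDeriv_potential_mul_left hr hM hb ScatFam.sol a).comp (Continuous.prodMk_right u)
  have hVac : ∀ u, Continuous fun v ↦ Va u v := by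
    intro u
    have hc := hr.continuous_snd u
    have hne : ∀ v, r u v ≠ 0 := fun v ↦ (hr.pos hM.le u v).ne'
    have hfun : (fun v ↦ Va u v) = fun v ↦ (-1) ^ a * ((r u v ^ (3 + a))⁻¹ * S.eval (r u v)⁻¹) := funext (hVa_eq u)
    rw [hfun]
    exact continuous_const.mul (((hc.pow _).inv₀ fun v ↦ pow_ne_zero _ (hne v)).mul
      (S.continuous.comp (hc.inv₀ hne)))
  have hGc : ∀ u, Continuous fun v ↦ G u v := fun u ↦ (hFac u).sub ((hVac u).mul hHd.continuous)
  -- the main estimates at a point `(u, v)`, `u ≤ U₀`, `v ≥ v₁`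
  have main : ∀ u, u ≤ U₀ → ∀ v, v₁ ≤ v →
      |iteratedDeriv (a + 1) (fun u' ↦ χ u' v) u| ≤ C₁ * ((-u) ^ (3 + a))⁻¹ ∧
      (v₂ ≤ v → |iteratedDeriv (a + 1) (fun u' ↦ χ u' v) u +
        (M * ∫ v' in v₁..v₂, H v') * ((a + 2).factorial : ℝ) * ((-u) ^ (3 + a))⁻¹| ≤
        C₂ * Real.log (-u) * ((-u) ^ (4 + a))⁻¹) := by
    intro u hu v hv
    have hu0 : 0 < -u := hR.neg_pos hu
    have hu1 : 1 ≤ -u := hR.one_le hu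
    have hlog := hR.one_le_log hu
    -- (F1) `∂ᵤ^{a+1} χ = −∫_{v₁}^{v} Fa`
    have e1 : iteratedDeriv (a + 1) (fun u' ↦ χ u' v) u = -∫ v' in v₁..v, Fa u v' := by
      rw [iteratedDeriv_succ_field_left hr hM hb a u v, vPrimitive_apply]
    -- (F2) Leibniz and the split `Fa = Va H + Σ C(a,i) ∂ᵤ^iV ∂ᵤ^{a-i}(χ − H)`
    have e2 : ∀ v', Fa u v' = Va u v' * H v' + ∑ i ∈ Finset.range (a + 1),
        (a.choose i : ℝ) * iteratedDeriv i (fun u' ↦ radialPotential M (r u' v')) u *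
          iteratedDeriv (a - i) (fun u' ↦ χ u' v' - H v') u := by
      intro v'
      have hVc : ContDiffAt ℝ a (fun u' ↦ radialPotential M (r u' v')) u :=
        ((contDiff_potential_left hr hM v').of_le hle).contDiffAt
      have hχc : ContDiffAt ℝ a (fun u' ↦ χ u' v') u := ((contDiff_field_left hr hM hb v').of_le hle).contDiffAt
      simp only [hFa, hVa]
      rw [iteratedDeriv_fun_mul hVc hχc]
      -- each term: `∂ᵤ^{a-i} χ = ∂ᵤ^{a-i}(χ − H) + [a - i = 0] H`
      have hterm : ∀ i ∈ Finset.range (a + 1), (a.choose i : ℝ) * iteratedDeriv i (fun u' ↦ radialPotential M (r u' v')) u *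
          iteratedDeriv (a - i) (fun u' ↦ χ u' v') u =
          (a.choose i : ℝ) * iteratedDeriv i (fun u' ↦ radialPotential M (r u' v')) u *
            iteratedDeriv (a - i) (fun u' ↦ χ u' v' - H v') u +
          (if i = a then iteratedDeriv a (fun u' ↦ radialPotential M (r u' v')) u * H v' else 0) := by
        intro i hi
        have hia : i ≤ a := Nat.lt_succ_iff.mp (Finset.mem_range.mp hi)
        rcases eq_or_lt_of_le hia with rfl | hlt
        · simp only [Nat.sub_self, iteratedDeriv_zero, Nat.choose_self, Nat.cast_one, one_mul, if_true]
          ring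
        · rw [if_neg (ne_of_lt hlt), add_zero, iteratedDeriv_sub_data (by omega)]
      rw [Finset.sum_congr rfl hterm, Finset.sum_add_distrib, Finset.sum_ite_eq' (Finset.range (a + 1)) a,
        if_pos (Finset.mem_range.2 (Nat.lt_succ_self a))]
      ring
    -- (F3) the bound on `G(u, v')` for `v' ≥ v₁`
    have e3 : ∀ v', v₁ ≤ v' → |G u v'| ≤ T * (((-u) ^ (2 + a))⁻¹ * (r u v' ^ (0 + 2 + 1))⁻¹) := by
      intro v' hv'
      have hr0 : 0 < r u v' := hr.pos hM.le u v'
      have hρ : (r u v')⁻¹ ≤ 2 / -u := hR.inv_radius_le hr hM hu hv'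
      have hGeq : G u v' = ∑ i ∈ Finset.range (a + 1),
          (a.choose i : ℝ) * iteratedDeriv i (fun u' ↦ radialPotential M (r u' v')) u *
            iteratedDeriv (a - i) (fun u' ↦ χ u' v' - H v') u := by
        simp only [hG]; rw [e2 v']; ring
      rw [hGeq]
      have hterm : ∀ i ∈ Finset.range (a + 1), |(a.choose i : ℝ) * iteratedDeriv i (fun u' ↦ radialPotential M (r u' v')) u *
          iteratedDeriv (a - i) (fun u' ↦ χ u' v' - H v') u| ≤
          (a.choose i : ℝ) * K i * 2 ^ i * Cp * (((-u) ^ (2 + a))⁻¹ * (r u v' ^ 3)⁻¹) := by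
        intro i hi
        have hia : i ≤ a := Nat.lt_succ_iff.mp (Finset.mem_range.mp hi)
        rw [abs_mul, abs_mul, Nat.abs_cast]
        have h1 := hK i u v'
        have h2 := hprev (a - i) (Nat.sub_le a i) u hu v' hv'
        -- `ρ^{3+i} ≤ ρ³ (2/|u|)^i` and `|u|^{-(2+(a-i))} (2/|u|)^i = 2^i |u|^{-(2+a)}`
        have hρi : (r u v' ^ (3 + i))⁻¹ ≤ (r u v' ^ 3)⁻¹ * (2 / -u) ^ i := by
          rw [pow_add, mul_inv]
          refine mul_le_mul_of_nonneg_left ?_ (by positivity)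
          rw [← inv_pow]
          exact pow_le_pow_left₀ (by positivity) hρ i
        have hexp : ((-u) ^ (2 + (a - i)))⁻¹ * (2 / -u) ^ i = 2 ^ i * ((-u) ^ (2 + a))⁻¹ := by
          rw [div_pow, div_eq_mul_inv, show (2 + a) = (2 + (a - i)) + i by omega, pow_add, mul_inv]
          ring
        calc (a.choose i : ℝ) * |iteratedDeriv i (fun u' ↦ radialPotential M (r u' v')) u| *
              |iteratedDeriv (a - i) (fun u' ↦ χ u' v' - H v') u|
            ≤ (a.choose i : ℝ) * (K i * ((r u v' ^ 3)⁻¹ * (2 / -u) ^ i)) * (Cp * ((-u) ^ (2 + (a - i)))⁻¹) :=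
              mul_le_mul (mul_le_mul_of_nonneg_left (h1.trans (mul_le_mul_of_nonneg_left hρi (hK0 i)))
                (Nat.cast_nonneg _)) h2 (abs_nonneg _)
                (mul_nonneg (Nat.cast_nonneg _) (mul_nonneg (hK0 i) (by positivity)))
          _ = (a.choose i : ℝ) * K i * Cp * (r u v' ^ 3)⁻¹ * (((-u) ^ (2 + (a - i)))⁻¹ * (2 / -u) ^ i) := by ring
          _ = (a.choose i : ℝ) * K i * 2 ^ i * Cp * (((-u) ^ (2 + a))⁻¹ * (r u v' ^ 3)⁻¹) := by
              rw [hexp]; ring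
      refine (Finset.abs_sum_le_sum_abs _ _).trans ((Finset.sum_le_sum hterm).trans (le_of_eq ?_))
      rw [← Finset.sum_mul, show 0 + 2 + 1 = 3 by norm_num]
    -- (F5) `∫ Fa = ∫ Va H + ∫ G`
    have hcHV : Continuous fun v' ↦ H v' * Va u v' := hHd.continuous.mul (hVac u)
    have e5 : ∫ v' in v₁..v, Fa u v' = (∫ v' in v₁..v, H v' * Va u v') + ∫ v' in v₁..v, G u v' := by
      rw [← intervalIntegral.integral_add (hcHV.intervalIntegrable _ _) ((hGc u).intervalIntegrable _ _)]
      refine intervalIntegral.integral_congr fun v' _ ↦ ?_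
      simp only [hG]; ring
    -- (F6) the outgoing rule for `G`
    have e6 : |∫ v' in v₁..v, G u v'| ≤ 4 * T * ((-u) ^ (4 + a))⁻¹ := by
      have h := abs_integral_right_le hr hM (hR.toLeft h12) (a := 2 + a) (b := 1) hu le_rfl hv
        (h := G) (C := T) (fun v' hv' ↦ by have := e3 v' hv'.1; simpa using this)
      refine h.trans ?_
      have h4 : (r u v₁)⁻¹ ≤ 2 / -u := hR.inv_radius_le hr hM hu le_rfl
      have hr1 : 0 < r u v₁ := hr.pos hM.le u v₁
      have h5 : (((1 : ℕ) : ℝ) + 1)⁻¹ * (r u v₁ ^ (1 + 1))⁻¹ ≤ (1 / 2) * (2 / -u) ^ 2 := by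
        push_cast
        rw [show (r u v₁ ^ (1 + 1))⁻¹ = ((r u v₁)⁻¹) ^ 2 by rw [inv_pow]]
        exact mul_le_mul (by norm_num) (pow_le_pow_left₀ (by positivity) h4 2) (by positivity) (by norm_num)
      rw [mul_inv]
      calc 2 * T * (((-u) ^ (2 + a))⁻¹ * ((((1 : ℕ) : ℝ) + 1)⁻¹ * (r u v₁ ^ (1 + 1))⁻¹))
          ≤ 2 * T * (((-u) ^ (2 + a))⁻¹ * ((1 / 2) * (2 / -u) ^ 2)) :=
            mul_le_mul_of_nonneg_left (mul_le_mul_of_nonneg_left h5 (by positivity)) (by positivity)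
        _ = 4 * T * ((-u) ^ (4 + a))⁻¹ := by
            rw [show 4 + a = (2 + a) + 2 by ring, pow_add, mul_inv, div_pow]; ring
    -- (F7) the data term, crude bound
    have hVbnd : ∀ v' ∈ Icc v₁ v₂, |Va u v'| ≤ K a * (2 / -u) ^ (3 + a) := by
      intro v' hv'
      have hr0 : 0 < r u v' := hr.pos hM.le u v'
      refine (hK a u v').trans (mul_le_mul_of_nonneg_left ?_ (hK0 a))
      rw [← inv_pow]
      exact pow_le_pow_left₀ (by positivity) (hR.inv_radius_le hr hM hu hv'.1) _
    have e7 : |∫ v' in v₁..v, H v' * Va u v'| ≤ (v₂ - v₁) * CH * (K a * (2 / -u) ^ (3 + a)) :=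
      abs_integral_data_mul_le' hHd.continuous hsupp hHb h12 (hVac u) (by have := hK0 a; positivity) hVbnd hv
    refine ⟨?_, fun hv2 ↦ ?_⟩
    · -- the crude bound `K1(a+1)`
      rw [e1, abs_neg, e5]
      refine (abs_add_le _ _).trans ?_
      refine (add_le_add e7 e6).trans ?_
      have h1 : (2 / -u) ^ (3 + a) = 2 ^ (3 + a) * ((-u) ^ (3 + a))⁻¹ := by rw [div_pow, div_eq_mul_inv]
      have h2 : ((-u) ^ (4 + a))⁻¹ ≤ ((-u) ^ (3 + a))⁻¹ :=
        inv_anti₀ (by positivity) (pow_le_pow_right₀ hu1 (by omega))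
      rw [h1]
      have h3 : 4 * T * ((-u) ^ (4 + a))⁻¹ ≤ 4 * T * ((-u) ^ (3 + a))⁻¹ := mul_le_mul_of_nonneg_left h2 (by positivity)
      calc (v₂ - v₁) * CH * (K a * (2 ^ (3 + a) * ((-u) ^ (3 + a))⁻¹)) + 4 * T * ((-u) ^ (4 + a))⁻¹
          ≤ (v₂ - v₁) * CH * (K a * (2 ^ (3 + a) * ((-u) ^ (3 + a))⁻¹)) + 4 * T * ((-u) ^ (3 + a))⁻¹ := by linarith
        _ = C₁ * ((-u) ^ (3 + a))⁻¹ := by simp only [hC₁]; ring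
    · -- the leading term for `v ≥ v₂`
      -- the data integral lives on `[v₁, v₂]`
      have hdat : ∫ v' in v₁..v, H v' * Va u v' = ∫ v' in v₁..v₂, H v' * Va u v' := by
        rw [← intervalIntegral.integral_add_adjacent_intervals (b := v₂)
          (hcHV.intervalIntegrable _ _) (hcHV.intervalIntegrable _ _)]
        have hz : ∫ v' in v₂..v, H v' * Va u v' = 0 := by
          rw [intervalIntegral.integral_congr (g := fun _ ↦ (0 : ℝ)) (fun v' hv' ↦ ?_)]
          · simp
          · rw [uIcc_of_le hv2] at hv'
            simp [data_eq_zero_of_ge hsupp hv'.1]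
        rw [hz, add_zero]
      -- split `Va = (a+2)! M ρ^{3+a} + (−1)^a ρ^{3+a}(S(ρ) − S(0))` and `ρ^{3+a} = |u|^{-(3+a)} + strip error`
      set φ₁ : ℝ → ℝ := fun v' ↦ (r u v' ^ (3 + a))⁻¹ - ((-u) ^ (3 + a))⁻¹ with hφ₁
      set φ₂ : ℝ → ℝ := fun v' ↦ (-1) ^ a * (r u v' ^ (3 + a))⁻¹ * (S.eval (r u v')⁻¹ - S.eval 0) with hφ₂
      have hVsplit : ∀ v', Va u v' = ((a + 2).factorial : ℝ) * M * φ₁ v' +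
          ((a + 2).factorial : ℝ) * M * ((-u) ^ (3 + a))⁻¹ + φ₂ v' := by
        intro v'
        simp only [hVa, hφ₁, hφ₂, hS]
        rw [iteratedDeriv_potential_left_eq_leading hr hM]
        ring
      have hc1 : Continuous φ₁ :=
        (((hr.continuous_snd u).pow _).inv₀ fun v' ↦ pow_ne_zero _ (hr.pos hM.le u v').ne').sub continuous_const
      have hc2 : Continuous φ₂ := by
        have hc := hr.continuous_snd u
        have hne : ∀ v', r u v' ≠ 0 := fun v' ↦ (hr.pos hM.le u v').ne'
        exact (continuous_const.mul ((hc.pow _).inv₀ fun v' ↦ pow_ne_zero _ (hne v'))).mul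
          ((S.continuous.comp (hc.inv₀ hne)).sub continuous_const)
      have hI : ∫ v' in v₁..v₂, H v' * Va u v' = ((a + 2).factorial : ℝ) * M * (∫ v' in v₁..v₂, H v' * φ₁ v') +
          (M * ∫ v' in v₁..v₂, H v') * ((a + 2).factorial : ℝ) * ((-u) ^ (3 + a))⁻¹ +
          ∫ v' in v₁..v₂, H v' * φ₂ v' := by
        have hi1 : IntervalIntegrable (fun v' ↦ ((a + 2).factorial : ℝ) * M * (H v' * φ₁ v')) volume v₁ v₂ :=
          ((hHd.continuous.mul hc1).const_mul _).intervalIntegrable _ _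
        have hi2 : IntervalIntegrable (fun v' ↦ H v' * (((a + 2).factorial : ℝ) * M * ((-u) ^ (3 + a))⁻¹)) volume v₁ v₂ :=
          (hHd.continuous.mul continuous_const).intervalIntegrable _ _
        have hi3 : IntervalIntegrable (fun v' ↦ H v' * φ₂ v') volume v₁ v₂ := (hHd.continuous.mul hc2).intervalIntegrable _ _
        rw [← intervalIntegral.integral_const_mul,
          show (M * ∫ v' in v₁..v₂, H v') * ((a + 2).factorial : ℝ) * ((-u) ^ (3 + a))⁻¹ =
            ∫ v' in v₁..v₂, H v' * (((a + 2).factorial : ℝ) * M * ((-u) ^ (3 + a))⁻¹) by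
            rw [intervalIntegral.integral_mul_const]; ring,
          ← intervalIntegral.integral_add hi1 hi2, ← intervalIntegral.integral_add (hi1.add hi2) hi3]
        refine intervalIntegral.integral_congr fun v' _ ↦ ?_
        simp only [hVsplit v']
        ring
      -- bounds on the two error integrals
      have hb1 : |∫ v' in v₁..v₂, H v' * φ₁ v'| ≤
          (v₂ - v₁) * CH * (((3 + a : ℕ) : ℝ) * 4 ^ (3 + a) * A * Real.log (-u) / (-u) ^ (3 + a + 1)) :=
        abs_integral_data_mul_le' hHd.continuous hsupp hHb h12 hc1 (by positivity)
          (fun v' hv' ↦ abs_inv_radius_pow_sub_le hr hM hR (3 + a) hu hv') h12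
      have hb2 : |∫ v' in v₁..v₂, H v' * φ₂ v'| ≤ (v₂ - v₁) * CH * (KS * (2 / -u) ^ (4 + a)) := by
        refine abs_integral_data_mul_le' hHd.continuous hsupp hHb h12 hc2 (by positivity) (fun v' hv' ↦ ?_) h12
        have hr0 : 0 < r u v' := hr.pos hM.le u v'
        have hρ : (r u v')⁻¹ ≤ 2 / -u := hR.inv_radius_le hr hM hu hv'.1
        simp only [hφ₂]
        rw [abs_mul, abs_mul, abs_pow, abs_neg, abs_one, one_pow, one_mul, abs_of_pos (by positivity : (0:ℝ) < (r u v' ^ (3 + a))⁻¹)]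
        calc (r u v' ^ (3 + a))⁻¹ * |S.eval (r u v')⁻¹ - S.eval 0| ≤ (r u v' ^ (3 + a))⁻¹ * (KS * (r u v')⁻¹) :=
              mul_le_mul_of_nonneg_left (hKS u v') (by positivity)
          _ = KS * ((r u v')⁻¹) ^ (4 + a) := by rw [inv_pow, show 4 + a = (3 + a) + 1 by ring, pow_succ]; ring
          _ ≤ KS * (2 / -u) ^ (4 + a) := mul_le_mul_of_nonneg_left (pow_le_pow_left₀ (by positivity) hρ _) hKS0
      -- assemble
      rw [e1, e5, hdat, hI]
      have hkey : -((((a + 2).factorial : ℝ) * M * (∫ v' in v₁..v₂, H v' * φ₁ v') +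
          (M * ∫ v' in v₁..v₂, H v') * ((a + 2).factorial : ℝ) * ((-u) ^ (3 + a))⁻¹ +
          ∫ v' in v₁..v₂, H v' * φ₂ v') + ∫ v' in v₁..v, G u v') +
          (M * ∫ v' in v₁..v₂, H v') * ((a + 2).factorial : ℝ) * ((-u) ^ (3 + a))⁻¹ =
          -(((a + 2).factorial : ℝ) * M * (∫ v' in v₁..v₂, H v' * φ₁ v')) - (∫ v' in v₁..v₂, H v' * φ₂ v') -
          ∫ v' in v₁..v, G u v' := by ring
      rw [hkey]
      have htri : ∀ x y z : ℝ, |-x - y - z| ≤ |x| + |y| + |z| := fun x y z ↦ by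
        calc |-x - y - z| ≤ |-x - y| + |z| := abs_sub _ _
          _ ≤ |-x| + |y| + |z| := by gcongr; exact abs_sub _ _
          _ = |x| + |y| + |z| := by rw [abs_neg]
      refine (htri _ _ _).trans ?_
      rw [abs_mul, abs_of_nonneg (by positivity : (0 : ℝ) ≤ ((a + 2).factorial : ℝ) * M)]
      have hfac0 : (0 : ℝ) ≤ ((a + 2).factorial : ℝ) * M := by positivity
      have hP0 : 0 ≤ ((-u) ^ (4 + a))⁻¹ := by positivity
      have hb1' : |∫ v' in v₁..v₂, H v' * φ₁ v'| ≤
          (v₂ - v₁) * CH * (((3 + a : ℕ) : ℝ) * 4 ^ (3 + a) * A) * Real.log (-u) * ((-u) ^ (4 + a))⁻¹ :=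
        hb1.trans (le_of_eq (by rw [show 3 + a + 1 = 4 + a by ring]; ring))
      have hb2' : |∫ v' in v₁..v₂, H v' * φ₂ v'| ≤ (v₂ - v₁) * CH * (KS * 2 ^ (4 + a)) * ((-u) ^ (4 + a))⁻¹ :=
        hb2.trans (le_of_eq (by rw [div_pow, div_eq_mul_inv]; ring))
      have hB20 : 0 ≤ (v₂ - v₁) * CH * (KS * 2 ^ (4 + a)) := by positivity
      have hlogmul : ∀ x : ℝ, 0 ≤ x → x * ((-u) ^ (4 + a))⁻¹ ≤ x * Real.log (-u) * ((-u) ^ (4 + a))⁻¹ := by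
        intro x hx
        have h := mul_le_mul_of_nonneg_left hlog (mul_nonneg hx hP0)
        calc x * ((-u) ^ (4 + a))⁻¹ = x * ((-u) ^ (4 + a))⁻¹ * 1 := by ring
          _ ≤ x * ((-u) ^ (4 + a))⁻¹ * Real.log (-u) := h
          _ = x * Real.log (-u) * ((-u) ^ (4 + a))⁻¹ := by ring
      calc ((a + 2).factorial : ℝ) * M * |∫ v' in v₁..v₂, H v' * φ₁ v'| + |∫ v' in v₁..v₂, H v' * φ₂ v'| +
            |∫ v' in v₁..v, G u v'|
          ≤ ((a + 2).factorial : ℝ) * M * ((v₂ - v₁) * CH * (((3 + a : ℕ) : ℝ) * 4 ^ (3 + a) * A) * Real.log (-u) *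
              ((-u) ^ (4 + a))⁻¹) + (v₂ - v₁) * CH * (KS * 2 ^ (4 + a)) * ((-u) ^ (4 + a))⁻¹ +
            4 * T * ((-u) ^ (4 + a))⁻¹ := add_le_add (add_le_add (mul_le_mul_of_nonneg_left hb1' hfac0) hb2') e6
        _ ≤ ((a + 2).factorial : ℝ) * M * ((v₂ - v₁) * CH * (((3 + a : ℕ) : ℝ) * 4 ^ (3 + a) * A) * Real.log (-u) *
              ((-u) ^ (4 + a))⁻¹) + (v₂ - v₁) * CH * (KS * 2 ^ (4 + a)) * Real.log (-u) * ((-u) ^ (4 + a))⁻¹ +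
            4 * T * Real.log (-u) * ((-u) ^ (4 + a))⁻¹ := by
            linarith [hlogmul _ hB20, hlogmul (4 * T) (by positivity)]
        _ = C₂ * Real.log (-u) * ((-u) ^ (4 + a))⁻¹ := by simp only [hC₂]; ring
  refine ⟨max C₁ C₂, le_max_of_le_left hC₁0, fun u hu v hv ↦ ?_, fun u hu v hv ↦ ?_⟩
  · have hpos : 0 ≤ ((-u) ^ (3 + a))⁻¹ := by have := hR.neg_pos hu; positivity
    exact ((main u hu v hv).1).trans (mul_le_mul_of_nonneg_right (le_max_left _ _) hpos)
  · have hpos : 0 ≤ Real.log (-u) * ((-u) ^ (4 + a))⁻¹ := by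
      have := hR.neg_pos hu; have := hR.log_nonneg hu; positivity
    have h := (main u hu v (h12.trans hv)).2 hv
    calc _ ≤ C₂ * Real.log (-u) * ((-u) ^ (4 + a))⁻¹ := h
      _ = C₂ * (Real.log (-u) * ((-u) ^ (4 + a))⁻¹) := by ring
      _ ≤ max C₁ C₂ * (Real.log (-u) * ((-u) ^ (4 + a))⁻¹) := mul_le_mul_of_nonneg_right (le_max_right _ _) hpos
      _ = max C₁ C₂ * Real.log (-u) * ((-u) ^ (4 + a))⁻¹ := by ring

/-- **The base tower** ((6.17) at `n = 0` for all `u`-derivatives): for every `a` there is `C`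
with, for `j ≤ a` and `u ≤ U₀`: `|∂ᵤ^j(χ − H)(u, v)| ≤ C/|u|^{2+j}` for `v ≥ v₁`, and
`|∂ᵤ^j χ(u, v) + I₀ (j+1)!/|u|^{2+j}| ≤ C log|u|/|u|^{3+j}` for `v ≥ v₂` (`I₀ = M∫H`).
[cite: Kehrberger2022AHP, Thm. 6.1 eq. (6.3), proof of Thm. 6.2] -/
theorem uDeriv_base (a : ℕ) : ∃ C : ℝ, 0 ≤ C ∧
    (∀ j, j ≤ a → ∀ u, u ≤ U₀ → ∀ v, v₁ ≤ v →
      |iteratedDeriv j (fun u' ↦ scatteringField hr hM hHd.continuous hHb (data_eq_zero hsupp) u' v - H v) u| ≤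
        C * ((-u) ^ (2 + j))⁻¹) ∧
    (∀ j, j ≤ a → ∀ u, u ≤ U₀ → ∀ v, v₂ ≤ v →
      |iteratedDeriv j (fun u' ↦ scatteringField hr hM hHd.continuous hHb (data_eq_zero hsupp) u' v) u +
        (M * ∫ v' in v₁..v₂, H v') * ((j + 1).factorial : ℝ) * ((-u) ^ (2 + j))⁻¹| ≤
        C * Real.log (-u) * ((-u) ^ (3 + j))⁻¹) := by
  induction a with
  | zero =>
    have hB2 := sqConst_nonneg (v₁ := v₁) (v₂ := v₂) hM hHb h12
    have hCL : 0 ≤ logConst M CH v₁ v₂ A := VExp.logConst_nonneg hM hR h12 hHb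
    refine ⟨max (sqConst M CH v₁ v₂) (logConst M CH v₁ v₂ A), le_max_of_le_left hB2, ?_, ?_⟩
    · intro j hj u hu v _
      obtain rfl : j = 0 := Nat.le_zero.1 hj
      have h := abs_sub_data_le_sqConst hr hM hHd hsupp hHb hR h12 hu v
      rw [iteratedDeriv_zero]
      refine h.trans ?_
      rw [show (u ^ 2)⁻¹ = ((-u) ^ (2 + 0))⁻¹ by ring]
      exact mul_le_mul_of_nonneg_right (le_max_left _ _) (by have := hR.neg_pos hu; positivity)
    · intro j hj u hu v hv
      obtain rfl : j = 0 := Nat.le_zero.1 hj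
      have h := abs_add_moment_le hr hM hHd hsupp hHb hR h12 hu hv
      rw [iteratedDeriv_zero]
      simp only [zero_add, Nat.factorial_one, Nat.cast_one, mul_one, add_zero]
      rw [show ((-u) ^ 2)⁻¹ = (u ^ 2)⁻¹ by ring]
      refine h.trans ?_
      rw [show ((-u) ^ (3 + 0))⁻¹ = ((-u) ^ 3)⁻¹ by ring]
      exact mul_le_mul_of_nonneg_right (mul_le_mul_of_nonneg_right (le_max_right _ _) (hR.log_nonneg hu))
        (by have := hR.neg_pos hu; positivity)
  | succ a ih =>
    obtain ⟨C, hC0, hK1, hlead⟩ := ih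
    obtain ⟨C', hC'0, hK1', hlead'⟩ := uDeriv_succ_of_lower hr hM hHd hsupp hHb hR h12 a hC0 hK1
    refine ⟨max C C', le_max_of_le_left hC0, fun j hj u hu v hv ↦ ?_, fun j hj u hu v hv ↦ ?_⟩
    · have hpos : 0 ≤ ((-u) ^ (2 + j))⁻¹ := by have := hR.neg_pos hu; positivity
      rcases Nat.lt_or_ge j (a + 1) with hlt | hge
      · exact (hK1 j (by omega) u hu v hv).trans (mul_le_mul_of_nonneg_right (le_max_left _ _) hpos)
      · obtain rfl : j = a + 1 := le_antisymm hj hge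
        rw [iteratedDeriv_sub_data (by omega), show 2 + (a + 1) = 3 + a by ring]
        exact (hK1' u hu v hv).trans (mul_le_mul_of_nonneg_right (le_max_right _ _)
          (by have := hR.neg_pos hu; positivity))
    · have hpos : 0 ≤ Real.log (-u) * ((-u) ^ (3 + j))⁻¹ := by
        have := hR.neg_pos hu; have := hR.log_nonneg hu; positivity
      rcases Nat.lt_or_ge j (a + 1) with hlt | hge
      · have h := hlead j (by omega) u hu v hv
        calc _ ≤ C * Real.log (-u) * ((-u) ^ (3 + j))⁻¹ := h
          _ = C * (Real.log (-u) * ((-u) ^ (3 + j))⁻¹) := by ring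
          _ ≤ max C C' * (Real.log (-u) * ((-u) ^ (3 + j))⁻¹) := mul_le_mul_of_nonneg_right (le_max_left _ _) hpos
          _ = _ := by ring
      · obtain rfl : j = a + 1 := le_antisymm hj hge
        have h := hlead' u hu v hv
        rw [show a + 1 + 1 = a + 2 by ring, show 2 + (a + 1) = 3 + a by ring, show 3 + (a + 1) = 4 + a by ring]
        calc _ ≤ C' * Real.log (-u) * ((-u) ^ (4 + a))⁻¹ := h
          _ = C' * (Real.log (-u) * ((-u) ^ (4 + a))⁻¹) := by ring
          _ ≤ max C C' * (Real.log (-u) * ((-u) ^ (4 + a))⁻¹) :=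
              mul_le_mul_of_nonneg_right (le_max_right _ _) (by rw [show 4 + a = 3 + (a + 1) by ring]; exact hpos)
          _ = _ := by ring

end UDecayBase

end ScatDecay

end Literature.Barriers.FinalStateConjecture

end
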